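import Mathlib.AlgebraicGeometry.EllipticCurve.Weierstrass

/-!
# HodgeLocusCensusSupersingularC4 — the covariant `c₄` and the square class of `α₀ = j (j − 1728)` (pub-hlocus, ENGINE A, abs-1 gen 21)

HONEST FRAMING: certified instances and evidence bearing on the general Hodge conjecture; no claim.

Context (abs line, open row R4 of the cell ledger `ABSHODGE.md`): for a discriminant `D ∉ {-3, -4}` put `θ = j(O_D)`,
`F = ℚ(θ)`, `α₀ = θ (θ − 1728)`; the row asks whether `α₀ ∉ F^{×2}` for every `D` (certified per `D` for `4 < |D| ≤ 10⁴` by two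
engines; open in general).  This file anchors the ALGEBRA behind the gen-21 structural results of engine A
(`code/abs_engineA/xt/n1ss/DERIVATION-N1-SS-A.md`), all of which are statements about the covariant `c₄` of a Weierstrass model:

* (0.1) `c₄³ · (c₄³ − 1728 Δ) = c₄ · (c₄ c₆)²` (`c₄_cube_mul_c₄_cube_sub`), i.e. over a field with `Δ ≠ 0`:
  `j (j − 1728) = c₄ · (c₄ c₆ / Δ)²` (`j_mul_j_sub_eq`).  Hence `[α₀] = [c₄(E)]` in `F^×/F^{×2}` for ANY model `E` of the CM
  curve over any extension of `F` (and `θ = c₄³/Δ`, `θ − 1728 = c₆²/Δ` give `v(θ) = 3 v(c₄) − v(Δ)`, `v(θ − 1728) = 2 v(c₆) − v(Δ)`).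
* LEMMA T (paper; Serre–Tate, *Good reduction of abelian varieties*, Ann. Math. 88 (1968), §6 Thm 6 (a),(b) + §1 Thm 1; cf.
  Mentzelos, Pacific J. Math. 329 (2024), Lemma 2.1, arXiv:2405.13414): if NOT (`D₀ ∈ {-3,-4}` and `f = ℓ^k`, `k ≥ 1`), then at every
  prime `𝔓 | ℓ` of the ring class field `L = K(θ)` a quadratic twist of the CM curve has good reduction over `L_𝔓`, so
  `v_𝔓(θ) ≡ 0 (mod 3)` and `v_𝔓(θ − 1728) ≡ 0 (mod 2)`.  COROLLARY P: at a prime `𝔭` of `F` unramified in `L/F` a valuation witness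
  for `α₀ ∉ F^{×2}` is exactly an ODD `k_𝔭 = v_𝔭(θ)/3` (odd "depth" at a supersingular `j ≡ 0` prime).  Evidence: 3 957 033 + 77 928
  prime rows of the gen-20 profile data with 0 violations; all 39 rows of the excluded case violate (the hypothesis is sharp).
* LEMMA E3 (paper, elementary): `R` a DVR with `v(3) = 1`, `2 ∈ R^×`, `E/R` : `y² = x³ + a₂x² + a₄x + a₆` with `Δ ∈ R^×` and
  supersingular reduction.  In characteristic 3 "supersingular ⟺ j = 0 ⟺ b₂ = 0" (Mathlib: `WeierstrassCurve.j_eq_zero_iff_of_char_three`;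
  Hartshorne IV.4.21/4.23), so `b₂ = 4a₂ ∈ 3R`, say `b₂ = 3k`; then `c₄ = 3 (3k² − 8 b₄)` (`c₄_eq_of_b₂_eq_three_mul` below) and
  smoothness of `y² = x³ + ā₄ x + ā₆` forces `a₄ ∈ R^×`, so `v(c₄) = 1` and `v(j) = 3`.  Over `ℤ` the same algebra reads
  `3 ∣ b₂ → (3 ∣ c₄) ∧ (9 ∣ c₄ ↔ 3 ∣ b₄)` (`three_dvd_c₄_of_three_dvd_b₂`).
* THEOREM L3 (paper, from LEMMA T + LEMMA E3 + Deuring's criterion [Lang, *Elliptic Functions*, Ch. 13 Thm 12]): for every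
  `D ≡ 2 (mod 3)`, `D ≠ -4`, and EVERY prime `𝔭 | 3` of `F`: `e(𝔭|3) = 1`, `v_𝔭(θ) = 3`, `v_𝔭(θ − 1728)` even, hence `v_𝔭(α₀)` odd and
  `α₀ ∉ F^{×2}` — a uniform local witness for one third of all discriminants (1666 of the 4998 with `|D| ≤ 10⁴`; 272 of the 943
  'Vsplit-only' `D` that had no structural witness).  Evidence: 17 439 / 17 439 prime rows (gen 20) and the two-route recomputation
  LOC23-A (gen 21, kit) agree.
* PROPOSITION L2 (paper): `D ≡ 5 (mod 8)`: a twist-good model `y² + a₃ y = x³ + a₄ x + a₆` over `ℤ₄ = W(𝔽₄)` has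
  `c₄ = −48 a₄`, `c₆ = −216 (a₃² + 4 a₆)`, `Δ = −27 (a₃² + 4a₆)² − 64 a₄³` (`covariants_of_a₁_eq_zero_of_a₂_eq_zero` below), whence
  `v(θ − 1728) = 6`, `v(θ) = 12 + 3 v(a₄)` at every prime over 2, and `[α₀] = [a₄]` in `L_𝔓 = ℚ₄`; the parity of `v(a₄)` and the
  unit class are NOT controlled (example `D = -43`: `α₀ ∉ ℚ₂^{×2}` but `α₀ ∈ ℚ₄^{×2}`), which is what the LOC23-A census measures.
* PROPOSITION L2⁺ (paper + finite check over `𝔽₄`): for `D ≡ 5 (mod 8)`, `D ≠ -3`: `v(a₄) ≥ 1`, i.e. `v_𝔭(θ) ≥ 15` at every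
  `𝔭 | 2` (`c₄_of_lift_of_maximal_form`): the reduced embedding `O ↪ End(Ē)` is optimal [Lang, *Elliptic Functions*, Ch. 13 §3 Lemma 1
  and §4], so the Frobenius of `Ē/𝔽₄` is an element of norm 4 of `O`, i.e. `±2`; hence `#Ē(𝔽₄) ∈ {1, 9}` and `Ē ≅ (y² + y = x³ + c)` over `𝔽₄`
  (10 939 / 10 939 prime rows, `|D| ≤ 10⁴`).
* PROPOSITIONS S3 / S2 (paper, elementary from Deuring's criterion): if `D ≡ 1 (mod 3)` (resp. `D ≡ 1 (mod 8)`) then `3` (resp. `2`)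
  splits in `K`, the reduction at every prime over it is ordinary, so `θ` is a unit there (the only supersingular `j` in characteristic
  `2`, `3` is `0`), and since `1728 = 2⁶ · 3³` (`alpha0_eq_sq_mul_unit`: `θ (θ − 1728) = θ² (1 − 1728/θ)`) the unit `1 − 1728/θ` is
  `≡ 1 (mod 27)` (resp. `(mod 64)`), a local square: `α₀ ∈ F_𝔭^{×2}` at EVERY prime of `F` over `3` (resp. `2`) — those places are
  provably SILENT.  With L3 / L2 this decides every place over `3` (resp. `2`) when `3 ∤ D` (resp. `2 ∤ D`); only the ramified
  classes are left to the census (LOC23-A: every S2/S3 prime row reads `(v(θ), v(θ−1728), sq_F, sq_L) = (0, 0, 1, 1)`).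
* PROPOSITION R2 (paper, formal-group argument, DERIVATION §3c): if `2 ∣ D₀`, `2 ∤ f`, `D ≠ −4` (2 ramified in `K`, prime to the
  conductor) then at every prime `𝔓 ∣ 2` of `L` (`e(𝔓|2) = 2`): from `[2] = [2/ϖ²] ∘ [ϖ] ∘ [ϖ]` on the formal group and additivity of
  heights, `[ϖ] = ϖX + uX² + …` with `u` a unit, so comparing `X²`-coefficients with `[2](z) = 2z − a₁z² − …` gives `v_𝔓(a₁) = 1`
  (the Hasse invariant has 2-adic order ½); hence `v(b₂) = 2`, `v(c₄) = 4` (`c₄_of_ramified_lift`), `v_𝔓(θ) = 12` EXACTLY (`ord₂ θ = 6`),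
  and (comparing `X⁴`-coefficients too) `a₁⁶ + 216 a₃² ≡ 0 (mod 𝔓⁷)` (`c₆_of_ramified_lift`), so `v_𝔓(θ − 1728) ≥ 14`, even by LEMMA T.  OBSERVED (LOC23-A,
  all `1249` such `D` with `|D| ≤ 10⁴`, `8354` prime rows): `v_𝔓(θ) = 12` always; `v_𝔓(θ − 1728) = 14` exactly iff `D₀ ≡ 0 (mod 8)`
  (then a prime of `F` over 2 with `e = 1` carries the odd valuation `v_𝔭(α₀) = 13`), `≥ 16` iff `D₀ ≡ 4 (mod 8)`; and `α₀ ∉ F_𝔭^{×2}`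
  at EVERY prime over 2 in all `8354` rows — whereas for `2 ∣ D₀, 2 ∣ f` no prime over 2 is ever a witness (`418/418 D`).

Only the ring identities are formalised (Mathlib has no ring class fields or CM reduction theory); the valuation statements above
are carried by this docstring and the derivation file, with their sources.
-/

namespace Summit.HodgeConjecture.HodgeConjecture.HodgeLocus.Census.SupersingularC4

variable {R : Type*} [CommRing R] (W : WeierstrassCurve R)

/-- (0.1): `c₄³ (c₄³ − 1728 Δ) = c₄ (c₄ c₆)²` for every Weierstrass curve over any commutative ring
(from Mathlib's `c_relation : 1728 Δ = c₄³ − c₆²`).  With `j = c₄³/Δ`: `j (j − 1728) · Δ² = c₄ · (c₄ c₆)²`. -/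
theorem c₄_cube_mul_c₄_cube_sub : W.c₄ ^ 3 * (W.c₄ ^ 3 - 1728 * W.Δ) = W.c₄ * (W.c₄ * W.c₆) ^ 2 := by
  rw [W.c_relation]; ring

/-- `θ − 1728 = c₆²/Δ`: the numerator identity `c₄³ − 1728 Δ = c₆²`. -/
theorem c₄_cube_sub_eq_c₆_sq : W.c₄ ^ 3 - 1728 * W.Δ = W.c₆ ^ 2 := by
  rw [W.c_relation]; ring

/-- (0.1) over a field: `j (j − 1728) = c₄ · (c₄ c₆ / Δ)²`, so `α₀ = j (j − 1728)` and `c₄` have the same class modulo squares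
whenever `c₄ c₆ ≠ 0` (i.e. `j ∉ {0, 1728}`). -/
theorem j_mul_j_sub_eq {K : Type*} [Field K] (E : WeierstrassCurve K) [E.IsElliptic] :
    E.j * (E.j - 1728) = E.c₄ * (E.c₄ * E.c₆ / E.Δ) ^ 2 := by
  have hΔ : E.Δ ≠ 0 := by rw [← E.coe_Δ']; exact E.Δ'.ne_zero
  have hj : E.j * E.Δ = E.c₄ ^ 3 := by
    rw [WeierstrassCurve.j, ← E.coe_Δ', mul_comm, ← mul_assoc, Units.mul_inv, one_mul]
  have hj' : E.j = E.c₄ ^ 3 / E.Δ := by rw [eq_div_iff hΔ]; exact hj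
  rw [hj']
  field_simp
  linear_combination (-(E.c₄ ^ 3)) * E.c_relation

/-- Normal form `y² = x³ + a₂ x² + a₄ x + a₆` (`a₁ = a₃ = 0`): `c₄ = 16 (a₂² − 3 a₄)`. -/
theorem c₄_of_a₁_eq_zero_of_a₃_eq_zero (h₁ : W.a₁ = 0) (h₃ : W.a₃ = 0) :
    W.c₄ = 16 * (W.a₂ ^ 2 - 3 * W.a₄) := by
  simp only [WeierstrassCurve.c₄, WeierstrassCurve.b₂, WeierstrassCurve.b₄, h₁, h₃]; ring

/-- Same normal form: `c₆ = −32 (2 a₂³ − 9 a₂ a₄ + 27 a₆)` and `Δ = −16 (4 a₂³ a₆ − a₂² a₄² − 18 a₂ a₄ a₆ + 4 a₄³ + 27 a₆²)`. -/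
theorem c₆_Δ_of_a₁_eq_zero_of_a₃_eq_zero (h₁ : W.a₁ = 0) (h₃ : W.a₃ = 0) :
    W.c₆ = -32 * (2 * W.a₂ ^ 3 - 9 * W.a₂ * W.a₄ + 27 * W.a₆) ∧
    W.Δ = -16 * (4 * W.a₂ ^ 3 * W.a₆ - W.a₂ ^ 2 * W.a₄ ^ 2 - 18 * W.a₂ * W.a₄ * W.a₆ + 4 * W.a₄ ^ 3 + 27 * W.a₆ ^ 2) := by
  constructor
  · simp only [WeierstrassCurve.c₆, WeierstrassCurve.b₂, WeierstrassCurve.b₄, WeierstrassCurve.b₆, h₁, h₃]; ring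
  · simp only [WeierstrassCurve.Δ, WeierstrassCurve.b₂, WeierstrassCurve.b₄, WeierstrassCurve.b₆, WeierstrassCurve.b₈, h₁, h₃]
    ring

/-- LEMMA E3, ring-theoretic core: if `b₂ = 3 k` then `c₄ = 3 (3 k² − 8 b₄)`.  Over a DVR with `v(3) = 1` and `2` a unit this gives
`v(c₄) = 1 ⟺ b₄ ∈ R^×`, and `v(c₄) ≥ 2` otherwise. -/
theorem c₄_eq_of_b₂_eq_three_mul {k : R} (hk : W.b₂ = 3 * k) : W.c₄ = 3 * (3 * k ^ 2 - 8 * W.b₄) := by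
  simp only [WeierstrassCurve.c₄, hk]; ring

/-- LEMMA E3 over `ℤ` (the absolutely unramified prototype): `3 ∣ b₂ → 3 ∣ c₄ ∧ (9 ∣ c₄ ↔ 3 ∣ b₄)`.  So for an integral model
`y² = x³ + a₂x² + a₄x + a₆` with supersingular reduction at 3 (`3 ∣ a₂`) and good reduction (`3 ∤ Δ`, forcing `3 ∤ a₄`, `b₄ = 2a₄`):
`v₃(c₄) = 1` and `v₃(j) = 3 − v₃(Δ) = 3`. -/
theorem three_dvd_c₄_of_three_dvd_b₂ (V : WeierstrassCurve ℤ) (h : (3 : ℤ) ∣ V.b₂) :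
    (3 : ℤ) ∣ V.c₄ ∧ ((9 : ℤ) ∣ V.c₄ ↔ (3 : ℤ) ∣ V.b₄) := by
  obtain ⟨k, hk⟩ := h
  have hc : V.c₄ = 3 * (3 * k ^ 2 - 8 * V.b₄) := c₄_eq_of_b₂_eq_three_mul V hk
  generalize k ^ 2 = K at hc
  refine ⟨⟨3 * K - 8 * V.b₄, hc⟩, ?_⟩
  rw [hc]
  omega

/-- In characteristic 3 the link "j = 0 ⟺ b₂ = 0" used in LEMMA E3 is Mathlib's `j_eq_zero_iff_of_char_three`
(the only supersingular `j` in characteristic 3 is `j = 0 = 1728`). -/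
example {S : Type*} [CommRing S] [CharP S 3] [IsReduced S] (V : WeierstrassCurve S) [V.IsElliptic] :
    V.j = 0 ↔ V.b₂ = 0 := V.j_eq_zero_iff_of_char_three

/-- PROPOSITION L2, ring-theoretic core: the normal form `y² + a₃ y = x³ + a₄ x + a₆` (`a₁ = a₂ = 0`) has
`c₄ = −48 a₄`, `c₆ = −216 (a₃² + 4 a₆)` and `Δ = −27 (a₃² + 4 a₆)² − 64 a₄³`.  Over `W(𝔽₄)` with `Δ` a unit: `a₃² + 4a₆` is a unit,
`v(c₆) = 3`, `v(c₄) = 4 + v(a₄)`, so `v(j − 1728) = 6`, `v(j) = 12 + 3 v(a₄)` and `[j (j − 1728)] = [c₄] = [−3 a₄] = [a₄]` (as `−3 ∈ ℚ₄^{×2}`). -/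
theorem covariants_of_a₁_eq_zero_of_a₂_eq_zero (h₁ : W.a₁ = 0) (h₂ : W.a₂ = 0) :
    W.c₄ = -48 * W.a₄ ∧ W.c₆ = -216 * (W.a₃ ^ 2 + 4 * W.a₆) ∧ W.Δ = -27 * (W.a₃ ^ 2 + 4 * W.a₆) ^ 2 - 64 * W.a₄ ^ 3 := by
  refine ⟨?_, ?_, ?_⟩
  · simp only [WeierstrassCurve.c₄, WeierstrassCurve.b₂, WeierstrassCurve.b₄, h₁, h₂]; ring
  · simp only [WeierstrassCurve.c₆, WeierstrassCurve.b₂, WeierstrassCurve.b₄, WeierstrassCurve.b₆, h₁, h₂]; ring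
  · simp only [WeierstrassCurve.Δ, WeierstrassCurve.b₂, WeierstrassCurve.b₄, WeierstrassCurve.b₆, WeierstrassCurve.b₈, h₁, h₂]
    ring

/-- PROPOSITION L2⁺, ring-theoretic core: a model congruent modulo 2 to `y² + y = x³ + a₆` — i.e. `a₁ = 2α`, `a₂ = 2β`, `a₃ = 1 + 2γ`,
`a₄ = 2δ` — has `c₄ = 16 (α⁴ − α) + 32 (2α²β + 2β² − α − 3δ − 3αγ)`.  Over `W(𝔽₄) = ℤ₂[ζ₃]` one has `α⁴ ≡ α (mod 2)`, hence
`v(c₄) ≥ 5` and `v(j) = 3 v(c₄) ≥ 15`.  (For `D ≡ 5 (mod 8)`, `D ≠ -3`, the twist-good model of the CM curve over `L_𝔓 = ℚ₄` has Frobenius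
`±2 ∈ ℤ` — it lies in `K ∩ End(Ē) = O_D`, whose norm-4 elements are `±2` — so `#Ē(𝔽₄) ∈ {1, 9}`, and the `𝔽₄`-isomorphism classes of `j = 0` curves with
1 or 9 points are `y² + y = x³ + c` (finite check over `𝔽₄`, two independent implementations, `code/abs_engineA/xt/n1ss/f4check/`);
lifting that isomorphism gives a model of the above shape.  Data: `v_𝔭(θ) ∈ {15, 18, 21, …}` at every `𝔭 | 2` for all 1249 such `D ≤ 10⁴`.) -/
theorem c₄_of_lift_of_maximal_form (α β γ δ : R) (h₁ : W.a₁ = 2 * α) (h₂ : W.a₂ = 2 * β) (h₃ : W.a₃ = 1 + 2 * γ)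
    (h₄ : W.a₄ = 2 * δ) :
    W.c₄ = 16 * (α ^ 4 - α) + 32 * (2 * α ^ 2 * β + 2 * β ^ 2 - α - 3 * δ - 3 * α * γ) := by
  simp only [WeierstrassCurve.c₄, WeierstrassCurve.b₂, WeierstrassCurve.b₄, h₁, h₂, h₃, h₄]; ring

/-- PROPOSITION R2, the bookkeeping step (Claim 2 of DERIVATION §3c): over a ring in which `2 = ϖ² ε` (a ramified quadratic
extension of `ℤ₂`) and `a₁ = ϖ α`, the covariant `c₄` is `ϖ⁴` times `(α² + ϖ²ε² a₂)² − 3ϖ³ε³ (α a₃ + ϖ ε a₄)`; when `α` is a unit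
(the Hasse invariant has order exactly `v(ϖ)`, Claim 1) the bracket is a unit, so `v(c₄) = 4 v(ϖ)` and `v(θ) = 12 v(ϖ)`. -/
theorem c₄_of_ramified_lift (ϖ ε α : R) (h2 : (2 : R) = ϖ ^ 2 * ε) (h₁ : W.a₁ = ϖ * α) :
    W.c₄ = ϖ ^ 4 * ((α ^ 2 + ϖ ^ 2 * ε ^ 2 * W.a₂) ^ 2 - 3 * ϖ ^ 3 * ε ^ 3 * (α * W.a₃ + ϖ * ε * W.a₄)) := by
  simp only [WeierstrassCurve.c₄, WeierstrassCurve.b₂, WeierstrassCurve.b₄, h₁]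
  linear_combination ((2 ^ 3 + 2 ^ 2 * (ϖ ^ 2 * ε) + 2 * (ϖ ^ 2 * ε) ^ 2 + (ϖ ^ 2 * ε) ^ 3) * (W.a₂ ^ 2 - 3 * W.a₄)
      + 2 * ϖ ^ 2 * α ^ 2 * W.a₂ * (2 + ϖ ^ 2 * ε) - 3 * ϖ * α * W.a₃ * (2 ^ 2 + 2 * (ϖ ^ 2 * ε) + (ϖ ^ 2 * ε) ^ 2)) * h2

/-- PROPOSITION R2, Claim 3 term list: with `a₁ = ϖ α` the covariant `c₆` expands as below; at a prime with `v(ϖ) = 1`, `v(2) = 2`,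
`α`, `a₃` units, the first and second terms have valuation `6`, the third `7`, and every remaining term `≥ 8`
(`12 = 2²·3`, `48 = 2⁴·3`, `64 = 2⁶`, `72 = 2³·9`, `288 = 2⁵·9`, `144 = 2⁴·9`, `864 = 2⁵·27`). -/
theorem c₆_of_ramified_lift (ϖ α : R) (h₁ : W.a₁ = ϖ * α) :
    W.c₆ = -(ϖ ^ 6 * α ^ 6) - 216 * W.a₃ ^ 2 + 36 * ϖ ^ 3 * α ^ 3 * W.a₃
      - 12 * ϖ ^ 4 * α ^ 4 * W.a₂ - 48 * ϖ ^ 2 * α ^ 2 * W.a₂ ^ 2 - 64 * W.a₂ ^ 3 + 72 * ϖ ^ 2 * α ^ 2 * W.a₄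
      + 288 * W.a₂ * W.a₄ + 144 * ϖ * α * W.a₂ * W.a₃ - 864 * W.a₆ := by
  simp only [WeierstrassCurve.c₆, WeierstrassCurve.b₂, WeierstrassCurve.b₄, WeierstrassCurve.b₆, h₁]; ring

/-- PROPOSITIONS S2/S3, the one-line algebra: for `θ ≠ 0` in a field, `θ (θ − 1728) = θ² · (1 − 1728/θ)`; at a prime where `θ` is a
unit and `1728 = 2⁶·3³ ≡ 0` to high order, the second factor is a principal unit, hence a local square. -/
theorem alpha0_eq_sq_mul_unit {K : Type*} [Field K] (θ : K) (hθ : θ ≠ 0) :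
    θ * (θ - 1728) = θ ^ 2 * (1 - 1728 / θ) := by
  have h : θ ^ 2 * (1 - 1728 / θ) = θ ^ 2 - θ * 1728 * (θ / θ) := by ring
  rw [h, div_self hθ]
  ring

example : (1728 : ℤ) = 2 ^ 6 * 3 ^ 3 := by norm_num

/-- Hand instance `D = -43` (h = 1, `θ = -960³`): `α₀ = θ (θ − 1728) = 2²⁴ · u` with `u = 46 656 091 125 ≡ 5 (mod 8)`, so `α₀` is not a
square in `ℚ₂ = F_𝔭` (unit squares are `≡ 1 (mod 8)`) although `5`, hence `α₀`, IS a square in `ℚ₂(√-43) = ℚ₄ = L_𝔓`: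
the obstruction is visible over `F` and invisible over the ring class field.  (Arithmetic only; the 2-adic statements are in the docstring.) -/
theorem alpha0_D43 : (-960 : ℤ) ^ 3 * ((-960 : ℤ) ^ 3 - 1728) = 2 ^ 24 * 46656091125 ∧ (46656091125 : ℤ) % 8 = 5 := by
  norm_num

/-- Hand instance `D = -163` (h = 1, `θ = -640320³`): `α₀ = 2²⁴ · u` with `u ≡ 7 (mod 8)`: not a square in `ℚ₂`, nor in `ℚ₄`
(`7 ∉ ℚ₄^{×2}`: the units of `ℤ₄` that are squares are `≡ X² (mod 4)`-lifts with trace condition; `7 ≡ 3 (mod 4)` already fails). -/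
theorem alpha0_D163 : (-640320 : ℤ) ^ 3 * ((-640320 : ℤ) ^ 3 - 1728) = 2 ^ 24 * 4108303370243867808584253375 ∧
    (4108303370243867808584253375 : ℤ) % 8 = 7 := by
  norm_num

end Summit.HodgeConjecture.HodgeConjecture.HodgeLocus.Census.SupersingularC4
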